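import Literature.NumberTheory.EllipticCurves.ManinConstantEdixhovenAtMostOnce
import Literature.NumberTheory.EllipticCurves.GlobalMinimalModel
import Literature.NumberTheory.EllipticCurves.Isogeny
import Literature.NumberTheory.DiophantineGeometry.Conductor
import Mathlib.NumberTheory.DirichletCharacter.Basic
import Mathlib.NumberTheory.Padics.PadicVal.Basic
import Mathlib.RingTheory.IntegralClosure.IsIntegral.Basic
import HarnessLib
import HarnessLib.Audit.Tags

/-!
# Candidates E-es-4 (★) / (♭) / (♯): KATO–TATE ADDITIVE INTEGRALITY of twisted special values and the
# resulting MANIN BOUND (`KatoTwistIntegralityAdditive`, `KatoTwistManinBound`, `UnitTwistManinCriterion`)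
# — cell `bsd-f2-manin` (D-0131 (3) frontier: the Manin constant at additive primes). `@[conjecture]`
# leaf (NOTHING asserted; definitions only; the proved glue (♭) ⟹ (♯) lives in `KatoTwistEdges.lean`).

HONEST FRAMING. LENS = Euler systems / explicit reciprocity (planner `bsd-f2-manin-es` g1, HOME
`run/shared/lean/pub/bsd-f2-manin/MEMO-es.md` §§9–11 and es/PROOF-es.md Lemma A / Prop C / Cor D), Props
VERBATIM from HOME/es/Sketch-es-g1.lean (sha16 03a85a17b998719d; audited copy HOME/ref1-C10-es-g1.lean) with
its two helper notions inlined: «no rational `p`-isogeny» `NoRatIsogenyOfDegree W p` =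
`∀ W′ (ψ : Isogeny W W′), ψ.degree ≠ p` (proxy for `E[p]` irreducible, kills the lattice defect), and the
even twisted plus-sum `S⁺_f(χ) = ∑_{a mod m} χ(a) · re {∞, a/m}_f` =
`∑ a : ZMod m, χ a * ((plusSymbol f (a/m)).re : ℂ)` (Birch–Manin / MTT (I.8.6) normalisation).
Setting: `W` globally minimal, `p` an ODD prime of ADDITIVE reduction (`p ∣ Δ_min ∧ p ∣ c₄` of the
integral model), no rational `p`-isogeny, `χ` an even primitive QUADRATIC Dirichlet character of conductor
`m` prime to `pN`, `D` a parametrisation datum at the conductor level (for (♭)/(♯): of minimal degree among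
the data with the same newform, i.e. the `X₀(N)`-optimal one). MECHANISM (memo §9, PROOF-es): Kato zeta
elements are integral in `T_p E` (Kato 2004 Thm 12.5 / (8.1.3); Wuthrich 2014 Prop. 8),
`exp*_{ω_E}(H¹(ℚ_p(ζ_m)_v, T_pE)) ⊆ p⁻¹·O_v` by Tate local duality + the Honda-integral formal logarithm at
an additive prime (tree `norm_coeff_formalLog_le_one_of_dvd_of_dvd`), and Kato's reciprocity law (Thm 9.7 +
6.6) turns `exp*` of the twisted zeta element into `S⁺_f(χ)·c_φ/Ω(W)`-type periods.

THE ROWS. (★) `KatoTwistIntegralityAdditive`: `S⁺_f(χ)/Ω(W)` (`Ω(W) = W.realPeriodRat`) has `p`-adic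
denominator at most `p¹`: `∃ u`, `p ∤ u`, `u·p·S⁺_f(χ)/Ω(W)` an algebraic integer. (♭) `KatoTwistManinBound`:
for the optimal datum, `c(D) ∣ u·p·A⁺_f(χ)` in algebraic integers (`A⁺_f(χ) = ∑ χ(a)[a/m]⁺_f` in the units
of `normalizedPlusSymbol`) — `ord_p c₀ ≤ 1 + ord_𝔭 A⁺_f(χ)`, NO modular degree in the bound. (♯)
`UnitTwistManinCriterion`: if some admissible `χ` has `A⁺_f(χ) = r ∈ ℚ` with `p ∤ num r` then `p² ∤ c(D)`.
BC5 WITNESS: habitat / unit-twist tables HOME/es/*.tsv (memo §§9.4, 10; K4 at `p ≥ 11`: 273/273 optimal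
curves with `p² ∣ N`, N ≤ 2400 have a `p`-unit quadratic twist). Refuter verdicts: REF1 **(★), (♭), (♯),
glue SURVIVE as typed** 2026-08-27T16:22Z (HOME/REFUTER-ref1.md §R6: rc 0, 4/4 BC7 CLEAN; T7 traps:
`Ω(W) = realPeriodRat > 0` so no `x/0` junk; `u = 0`, `r = 0` excluded by `¬ p ∣ u`, `¬ p ∣ r.num`; for
quadratic even `χ` the ratio `S⁺/Ω(W)` is rational, so the `∃u`-integrality is exactly `ord_p ≥ −1` — not
vacuous, not trivial; class-wide `∀D` consistent because `E[p]` irreducible ⇒ prime-to-`p` isogenies; (♭)'s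
`y` is forced `∈ ℤ`); REF2 (HOME/REFUTER-ref2.md, v3/v4): NEW-COMBINATION — forward half IN PRINT (Kato 2004
12.5/12.6/9.7; Kurihara–Nakamura / Kosters–Pannekoek `ω_E ↔ f dz` up to a `p`-adic unit under «Manin constant
prime to p»; Wuthrich 2014 Prop. 8 at odd SEMISTABLE `p`), backward half (ES-integrality ⇒ bound on
`ord_p c₀`) NOT-IN-PRINT; the planner's g2 correction (★•) with the Kosters–Pannekoek class (MEMO-es §12,
rows E-es-6/7/8) refines these and is typed separately once audited (R-es-5).
-/

noncomputable section

open scoped BigOperators MatrixGroups ModularForm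

open CongruenceSubgroup WeierstrassCurve
  Literature.NumberTheory.EllipticCurves Literature.NumberTheory.EllipticCurves.ModularForms

namespace Summit.BirchSwinnertonDyer.Rank1Residual.ManinAdditive

/-- **Candidate E-es-4 (★) `KatoTwistIntegralityAdditive` (cell bsd-f2-manin; THEOREM CANDIDATE modulo the
lens's K1, forward ingredients in print, nothing asserted):** `W` globally minimal, `p` an odd prime with
`p ∣ Δ_min(W)` and `p ∣ c₄` (additive reduction), no rational isogeny of degree `p`, `χ` an even primitive
quadratic Dirichlet character mod `m` with `gcd(m, pN) = 1`, `D` any parametrisation datum at level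
`N = W.conductorNorm ℤ`: there is `u ∈ ℕ` with `p ∤ u` such that `u · p · S⁺_{D.f}(χ) / Ω(W)` is an algebraic
integer, where `S⁺_f(χ) = ∑_{a mod m} χ(a)·re{∞, a/m}_f` and `Ω(W) = W.realPeriodRat`.
[cite: Kato2004Asterisque, Thm. 12.5 (Astérisque 295, held text p. 106; the integrality of zeta elements — the twisted-value
consequence at an ADDITIVE prime is NOT in print, cell bsd-f2-manin MEMO-es.md §9, E-es-4 (★))] -/
@[conjecture] def KatoTwistIntegralityAdditive : Prop :=
  ∀ (W : WeierstrassCurve ℚ) [W.IsElliptic] [W.IsGloballyMinimal] [NeZero (W.conductorNorm ℤ)]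
    (D : ModularParametrizationData W (W.conductorNorm ℤ)) (p : ℕ) [Fact p.Prime], p ≠ 2 →
    (p : ℤ) ∣ minimalDiscriminantInt W → (p : ℤ) ∣ (integralModelInt W).c₄ →
    (∀ (W' : WeierstrassCurve ℚ) (ψ : Isogeny W W'), ψ.degree ≠ p) →
    ∀ (m : ℕ) [NeZero m] (χ : DirichletCharacter ℂ m), m.Coprime (p * W.conductorNorm ℤ) →
      χ.IsPrimitive → χ ≠ 1 → MulChar.IsQuadratic χ → χ.Even →
      ∃ u : ℕ, ¬ p ∣ u ∧
        IsIntegral ℤ ((u : ℂ) * (p : ℂ) *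
          (∑ a : ZMod m, χ a * (((plusSymbol D.f ((ZMod.val a : ℚ) / m)).re : ℝ) : ℂ)) /
            (W.realPeriodRat : ℂ))

/-- **Candidate E-es-4 (♭) `KatoTwistManinBound` (cell bsd-f2-manin; the MANIN COROLLARY, NOT in print,
nothing asserted):** same setting with `D` of minimal modular degree among the data with the same newform
(the `X₀(N)`-optimal parametrisation): for every admissible `χ` there are `u ∈ ℕ`, `p ∤ u`, and an algebraic
integer `y` with `u · p · A⁺_{D.f}(χ) = c(D) · y`, `A⁺_f(χ) = ∑_{a mod m} χ(a) [a/m]⁺_f`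
(`normalizedPlusSymbol`) — i.e. `ord_p c(D) ≤ 1 + ord_𝔭 A⁺_f(χ)`, with no modular degree in the bound.
[cite: Kato2004Asterisque, Thm. 12.5 (Astérisque 295, held text p. 106; forward ingredient only — the Manin bound is NOT in
print, cell bsd-f2-manin MEMO-es.md §10, E-es-4 (♭))] -/
@[conjecture] def KatoTwistManinBound : Prop :=
  ∀ (W : WeierstrassCurve ℚ) [W.IsElliptic] [W.IsGloballyMinimal] [NeZero (W.conductorNorm ℤ)]
    (D : ModularParametrizationData W (W.conductorNorm ℤ)) (p : ℕ) [Fact p.Prime], p ≠ 2 →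
    (p : ℤ) ∣ minimalDiscriminantInt W → (p : ℤ) ∣ (integralModelInt W).c₄ →
    (∀ (W' : WeierstrassCurve ℚ) (ψ : Isogeny W W'), ψ.degree ≠ p) →
    (∀ (W' : WeierstrassCurve ℚ) [W'.IsElliptic]
      (D' : ModularParametrizationData W' (W.conductorNorm ℤ)),
      D'.f = D.f → D.modularDegree ≤ D'.modularDegree) →
    ∀ (m : ℕ) [NeZero m] (χ : DirichletCharacter ℂ m), m.Coprime (p * W.conductorNorm ℤ) →
      χ.IsPrimitive → χ ≠ 1 → MulChar.IsQuadratic χ → χ.Even →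
      ∃ u : ℕ, ¬ p ∣ u ∧ ∃ y : ℂ, IsIntegral ℤ y ∧
        (u : ℂ) * (p : ℂ) *
            (∑ a : ZMod m, χ a * ((normalizedPlusSymbol D.f ((ZMod.val a : ℚ) / m) : ℝ) : ℂ))
          = (D.maninConstant : ℂ) * y

/-- **Candidate E-es-4 (♯) `UnitTwistManinCriterion` (cell bsd-f2-manin; the lens's LAW in partition
currency, NOT in print, nothing asserted):** same setting, `D` optimal as in (♭): if SOME even primitive
quadratic `χ` of conductor `m` prime to `pN` has `A⁺_{D.f}(χ) = r ∈ ℚ` with `p ∤ num(r)`, then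
`p² ∤ c(D)` (`ord_p c(D) ≤ 1`; the sharp `p ∤ c(D)` needs the local invariant `λ_p(E) = 0`, the planner's
definition request D-es-1).
[cite: Kato2004Asterisque, Thm. 12.5 (Astérisque 295, held text p. 106; forward ingredient only — the criterion is NOT in
print, cell bsd-f2-manin MEMO-es.md §10, E-es-4 (♯))] -/
@[conjecture] def UnitTwistManinCriterion : Prop :=
  ∀ (W : WeierstrassCurve ℚ) [W.IsElliptic] [W.IsGloballyMinimal] [NeZero (W.conductorNorm ℤ)]
    (D : ModularParametrizationData W (W.conductorNorm ℤ)) (p : ℕ) [Fact p.Prime], p ≠ 2 →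
    (p : ℤ) ∣ minimalDiscriminantInt W → (p : ℤ) ∣ (integralModelInt W).c₄ →
    (∀ (W' : WeierstrassCurve ℚ) (ψ : Isogeny W W'), ψ.degree ≠ p) →
    (∀ (W' : WeierstrassCurve ℚ) [W'.IsElliptic]
      (D' : ModularParametrizationData W' (W.conductorNorm ℤ)),
      D'.f = D.f → D.modularDegree ≤ D'.modularDegree) →
    (∃ (m : ℕ) (_ : NeZero m) (χ : DirichletCharacter ℂ m) (r : ℚ), m.Coprime (p * W.conductorNorm ℤ) ∧
      χ.IsPrimitive ∧ χ ≠ 1 ∧ MulChar.IsQuadratic χ ∧ χ.Even ∧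
      (∑ a : ZMod m, χ a * ((normalizedPlusSymbol D.f ((ZMod.val a : ℚ) / m) : ℝ) : ℂ)) = (r : ℂ) ∧
      ¬ (p : ℤ) ∣ r.num) →
    ¬ (p : ℤ) ^ 2 ∣ D.maninConstant

end Summit.BirchSwinnertonDyer.Rank1Residual.ManinAdditive

end
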